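import Literature.NumberTheory.EllipticCurves.PointReduction
import HarnessLib

/-!
# `x(P) − x(Q)` is a unit for prime-to-`p` torsion points `P ≠ ±Q` under good reduction
# (Silverman AEC VII.3.1(b); de Shalit II.4.9 (i): «`℘(Ω, L) − ℘(v, L)` … is a `𝔭`-adic unit since `(𝔣, 𝔞) = 1`»)

Topic `Literature/NumberTheory/EllipticCurves` (theorems only; no definition, no named fact, no instance).  Setting of the tree's
`PointReduction` (`w : Valuation L ℝ≥0`, `V` a `w`-integral Weierstrass equation with GOOD reduction `w Δ = 1`, `r : 𝒪_w → k` with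
`ker r = 𝔪_w`, `goodTorsion w V` = the points killed by an integer of valuation `1`).  For two AFFINE prime-to-`p` torsion points
`P = (x₁, y₁)`, `Q = (x₂, y₂)`:

* ★ `val_sub_eq_one_of_mem_goodTorsion` — **`P ≠ Q`, `P ≠ −Q` ⟹ `w(x₁ − x₂) = 1`**: were `x₁ ≡ x₂ (mod 𝔪_w)`, the reductions
  `P̃, Q̃` would be affine points of `Ṽ` with the same abscissa, so `Q̃ = ±P̃` (`Affine.Y_eq_of_X_eq`), i.e. `(P ∓ Q)~ = Õ`; but
  reduction is injective on prime-to-`p` torsion (`injective_reduceHom`, AEC VII.3.1(b));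
* `val_sub_lt_one_iff_of_mem_goodTorsion` — conversely `w(x₁ − x₂) < 1 ↔ P = Q ∨ P = −Q`;
* `val_sub_eq_one_of_mem_goodTorsion_of_add_ne` — the form with `P − Q ≠ O`, `P + Q ≠ O`.
This is the arithmetic input of de Shalit II.4.9 (i) (the hypothesis `hu` of `DeShalitThetaTExpansionIntegral`): for `P₀ = ξ(Ω) ∈ E[𝔣]`
and `C = ξ(v) ∈ E[𝔞] ∖ O` with `(𝔣𝔞, 𝔭) = 1`, `(𝔣, 𝔞) = 1`, the constant term `x(P₀) − x(C) = ℘(Ω) − ℘(v)` is a `𝔓`-unit.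
Cell `bsd-print-cf2`, seat `bsd-line-cf2c-w4` g13 (B6 (ii-γ) arithmetic input); nothing about elliptic curves over number fields is proved.

## References
* [SilvermanAEC2009] J. H. Silverman, *The Arithmetic of Elliptic Curves*, 2nd ed. (2009), Prop. VII.3.1(b), VII.2.1.
* [deShalit1987] E. de Shalit, *Iwasawa theory of elliptic curves with complex multiplication* (1987), II §4.9 (proof of (i)), II §2.4
  (second proof of (iii)).
-/

noncomputable section

open scoped Classical NNReal
open WeierstrassCurve

universe u v

namespace Literature.NumberTheory.EllipticCurves

variable {L : Type u} [Field L] {w : Valuation L ℝ≥0} {k : Type v} [Field k] {r : w.integer →+* k}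
  {V : WeierstrassCurve L} [hV : V.IsIntegral w.integer]

/-- ★ **`w(x(P) − x(Q)) = 1` for affine prime-to-`p` torsion points `P ≠ ±Q` under good reduction** (`w Δ = 1`): reductions of
`±`-distinct prime-to-`p` torsion points have distinct abscissae.  [cite: SilvermanAEC2009, Prop. VII.3.1(b)]
[cite: deShalit1987, II §4.9 (proof of (i))] -/
theorem val_sub_eq_one_of_mem_goodTorsion (hr : ∀ a : w.integer, r a = 0 ↔ w (a : L) < 1) (hΔ : w V.Δ = 1)
    {x₁ y₁ x₂ y₂ : L} {h₁ : V.toAffine.Nonsingular x₁ y₁} {h₂ : V.toAffine.Nonsingular x₂ y₂}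
    (hP : (.some x₁ y₁ h₁ : V.toAffine.Point) ∈ goodTorsion w V) (hQ : (.some x₂ y₂ h₂ : V.toAffine.Point) ∈ goodTorsion w V)
    (hne : (.some x₁ y₁ h₁ : V.toAffine.Point) ≠ .some x₂ y₂ h₂)
    (hne' : (.some x₁ y₁ h₁ : V.toAffine.Point) ≠ -.some x₂ y₂ h₂) :
    w (x₁ - x₂) = 1 := by
  have hx₁ : w x₁ ≤ 1 := isIntegralPoint_of_mem_goodTorsion hP
  have hx₂ : w x₂ ≤ 1 := isIntegralPoint_of_mem_goodTorsion hQ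
  have hy₁ : w y₁ ≤ 1 := val_y_le_one h₁.1 hx₁
  have hy₂ : w y₂ ≤ 1 := val_y_le_one h₂.1 hx₂
  have hle : w (x₁ - x₂) ≤ 1 := w.map_sub_le hx₁ hx₂
  by_contra hne1
  have hlt : w (x₁ - x₂) < 1 := lt_of_le_of_ne hle hne1
  have hx : reduceFun r x₁ = reduceFun r x₂ := (reduceFun_eq_iff hr hx₁ hx₂).mpr hlt
  -- the reduced points
  have e₁ := reducePoint_some hr hΔ (rfl : reduceCurve r V = reduceCurve r V) h₁ hx₁
  have e₂ := reducePoint_some hr hΔ (rfl : reduceCurve r V = reduceCurve r V) h₂ hx₂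
  have hinj := injective_reduceHom hr hΔ (rfl : reduceCurve r V = reduceCurve r V)
  have heq₁ := equation_reduceFun (r := r) h₁.1 hx₁ hy₁
  have heq₂ := equation_reduceFun (r := r) h₂.1 hx₂ hy₂
  rcases Affine.Y_eq_of_X_eq heq₁ heq₂ hx with hy | hy
  · -- `P̃ = Q̃` ⟹ `P = Q`
    apply hne
    have h := @hinj ⟨_, hP⟩ ⟨_, hQ⟩ (by
      rw [reduceHom_apply, reduceHom_apply]
      change reducePoint w r (reduceCurve r V) (.some x₁ y₁ h₁) = reducePoint w r (reduceCurve r V) (.some x₂ y₂ h₂)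
      rw [e₁, e₂]
      exact point_some_eq_some hx hy)
    exact congrArg Subtype.val h
  · -- `P̃ = −Q̃` ⟹ `P = −Q`
    apply hne'
    have hQ' : (-(.some x₂ y₂ h₂ : V.toAffine.Point)) ∈ goodTorsion w V := neg_mem hQ
    have h := @hinj ⟨_, hP⟩ ⟨_, hQ'⟩ (by
      rw [reduceHom_apply, reduceHom_apply]
      change reducePoint w r (reduceCurve r V) (.some x₁ y₁ h₁) = reducePoint w r (reduceCurve r V) (-(.some x₂ y₂ h₂))
      rw [reducePoint_neg rfl, e₁, e₂, Affine.Point.neg_some]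
      exact point_some_eq_some hx hy)
    exact congrArg Subtype.val h

/-- **`w(x(P) − x(Q)) < 1 ↔ P = Q ∨ P = −Q`** for affine prime-to-`p` torsion points under good reduction.
[cite: SilvermanAEC2009, Prop. VII.3.1(b)] -/
theorem val_sub_lt_one_iff_of_mem_goodTorsion (hr : ∀ a : w.integer, r a = 0 ↔ w (a : L) < 1) (hΔ : w V.Δ = 1)
    {x₁ y₁ x₂ y₂ : L} {h₁ : V.toAffine.Nonsingular x₁ y₁} {h₂ : V.toAffine.Nonsingular x₂ y₂}
    (hP : (.some x₁ y₁ h₁ : V.toAffine.Point) ∈ goodTorsion w V) (hQ : (.some x₂ y₂ h₂ : V.toAffine.Point) ∈ goodTorsion w V) :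
    w (x₁ - x₂) < 1 ↔
      ((.some x₁ y₁ h₁ : V.toAffine.Point) = .some x₂ y₂ h₂ ∨ (.some x₁ y₁ h₁ : V.toAffine.Point) = -.some x₂ y₂ h₂) := by
  constructor
  · intro hlt
    by_contra hno
    push Not at hno
    exact absurd (val_sub_eq_one_of_mem_goodTorsion hr hΔ hP hQ hno.1 hno.2) (ne_of_lt hlt)
  · rintro (h | h)
    · simp only [Affine.Point.some.injEq] at h
      rw [h.1, sub_self, map_zero]; exact one_pos
    · rw [Affine.Point.neg_some] at h
      simp only [Affine.Point.some.injEq] at h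
      rw [h.1, sub_self, map_zero]; exact one_pos

/-- **The form with sums and differences**: `P − Q ≠ O`, `P + Q ≠ O` ⟹ `w(x(P) − x(Q)) = 1` (for `P ∈ E[𝔣]`, `Q ∈ E[𝔞] ∖ O` with
`(𝔣, 𝔞) = 1` both prime to `p`: `P ± Q ≠ O` since `E[𝔣] ∩ E[𝔞] = O`).  [cite: SilvermanAEC2009, Prop. VII.3.1(b)]
[cite: deShalit1987, II §4.9 (proof of (i))] -/
theorem val_sub_eq_one_of_mem_goodTorsion_of_sub_ne (hr : ∀ a : w.integer, r a = 0 ↔ w (a : L) < 1) (hΔ : w V.Δ = 1)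
    {x₁ y₁ x₂ y₂ : L} {h₁ : V.toAffine.Nonsingular x₁ y₁} {h₂ : V.toAffine.Nonsingular x₂ y₂}
    (hP : (.some x₁ y₁ h₁ : V.toAffine.Point) ∈ goodTorsion w V) (hQ : (.some x₂ y₂ h₂ : V.toAffine.Point) ∈ goodTorsion w V)
    (hsub : (.some x₁ y₁ h₁ : V.toAffine.Point) - .some x₂ y₂ h₂ ≠ 0)
    (hadd : (.some x₁ y₁ h₁ : V.toAffine.Point) + .some x₂ y₂ h₂ ≠ 0) :
    w (x₁ - x₂) = 1 :=
  val_sub_eq_one_of_mem_goodTorsion hr hΔ hP hQ (fun h => hsub (by rw [h, sub_self]))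
    (fun h => hadd (by rw [h, neg_add_cancel]))

/-- **Unit form**: for `a₁, a₂ ∈ 𝒪_w` the abscissae of `±`-distinct affine prime-to-`p` torsion points, `a₁ − a₂ ∈ 𝒪_wˣ` — the
hypothesis `hu : x₀ − x_c ∈ Rˣ` of `DeShalitThetaTExpansionIntegral` (`R = 𝒪_w`). [cite: SilvermanAEC2009, Prop. VII.3.1(b)]
[cite: deShalit1987, II §4.9 Proposition (i)] -/
theorem isUnit_sub_of_mem_goodTorsion (hr : ∀ a : w.integer, r a = 0 ↔ w (a : L) < 1) (hΔ : w V.Δ = 1)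
    {a₁ a₂ : w.integer} {y₁ y₂ : L} {h₁ : V.toAffine.Nonsingular (a₁ : L) y₁} {h₂ : V.toAffine.Nonsingular (a₂ : L) y₂}
    (hP : (.some (a₁ : L) y₁ h₁ : V.toAffine.Point) ∈ goodTorsion w V) (hQ : (.some (a₂ : L) y₂ h₂ : V.toAffine.Point) ∈ goodTorsion w V)
    (hne : (.some (a₁ : L) y₁ h₁ : V.toAffine.Point) ≠ .some (a₂ : L) y₂ h₂)
    (hne' : (.some (a₁ : L) y₁ h₁ : V.toAffine.Point) ≠ -.some (a₂ : L) y₂ h₂) :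
    IsUnit (a₁ - a₂) := by
  have h := val_sub_eq_one_of_mem_goodTorsion hr hΔ hP hQ hne hne'
  rw [Valuation.Integers.isUnit_iff_valuation_eq_one (Valuation.integer.integers w)]
  exact h

end Literature.NumberTheory.EllipticCurves
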